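/-
Copyright (c) 2026. All rights reserved.
Released under Apache 2.0 license as described in the file LICENSE.
Authors: abc-iut cell, statement-typer seat abc-iut-L4-t3 (wave 1).
-/
import Literature.AnabelianGeometry.AbsoluteAnabelian.LogFrobeniusContact
import Literature.AnabelianGeometry.AbsoluteAnabelian.DiagramUniversalTelecores

/-!
# [AbsTopIII] Corollary 5.5 (ii), the contact structure `ℋ_{An•}` CONSTRUCTED (structure functors over `𝒳`)

S. Mochizuki, *Topics in absolute anabelian geometry III: global reconstruction algorithms*,
J. Math. Sci. Univ. Tokyo 22 (2015) 939–1156 [MochizukiAbsTopIII2015]; locators `p.N` = pages of the author's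
manuscript (`paper:url-5493eb38cbb7`), read on the page: Cor 5.5 (ii) pp. 130–131, proof p. 132 l. 22–23
("Assertions (i), (ii) are immediate from the definitions").

`LogFrobeniusContact.lean` (this seat) types Cor 5.5 (ii) with the generators of the contact structure `ℋ_{An•}`
PINNED (`LogFrobeniusSetting.Cor55TelecoreContact`).  This file and its continuation
`LogFrobeniusContactProofs.lean` DISCHARGE it for every log-Frobenius setting `L` with `V(F_mod) ≠ ∅`, by
abc-iut-L4-t5's universal-family toolkit (`DiagramLifts` / `DiagramUniversalFamilies` / `DiagramUniversalTelecores`)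
exactly as in t5's discharge of Cor 3.6 (ii) (`AbsTopIII/FrobeniusPictureMLFTelecoreConstruction.lean`).  Here, the
CONSTRUCTION:

* structure functors of `D•_{≤5} ∪ {An•[𝒳]}` over `𝒳 = Th•_T[Z]` (`holOverX`, `holOverXIso`, `contactBase`): the
  identity at `□` and at the `𝒳_⋎`, `φ_{An•}` at `An•[𝒳]`, `κ_{An•} ⋙ φ_{An•}` after the natural functors to `ℰ•` on
  rows 3–5; the arrow `λ⊞_{v,ν}` lies over `𝒳` through "`λ⊞_{v,ν}` lies over `Th•[Z]`" (`lamOver`) followed by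
  `η_{An•} : φ_{An•} ∘ π_{An•} ≅ id_𝒳` — so that the lift along `[β¹_⋏]` will be the printed `η_⋏`;
* the structure functors of the telecore diagram `D_{An•}` (`contactOver` = t5's `teleOver`), the fully faithful vertex
  set `{An•[𝒳], □, 𝒳_⋎}` (`contactW`, `contactFF`) and the universal family `K` of `D_{An•}` (`contactUniv`);
* the printed generating pairs (`contactGen`, for chosen descending paths) and **`ℋ_{An•}`** = `K` restricted to their
  saturation (`contactFamily`; generated by the printed pairs by construction, `contactFamily_isGeneratedBy`).

The telecore `𝔗_{An•}`, the computation of the homotopies on the generators and the theorem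
`cor55TelecoreContact_holds` are in `LogFrobeniusContactProofs.lean`.  Pure category theory over the interface `L`;
refereed pre-IUT material; nothing here bears on [IUTchIII] Cor. 3.12.
-/

set_option autoImplicit false

universe u

open CategoryTheory Quiver

namespace Literature.AnabelianGeometry.AbsoluteAnabelian

namespace LogFrobeniusSetting

open DiagramOfCategories

variable {Vmod : Type u} {isArc : Vmod → Bool} (L : LogFrobeniusSetting Vmod isArc)

/-! ## Structure functors of `D•_{≤5} ∪ {An•[𝒳]}` over `𝒳` -/

/-- The structure functor of a holomorphic vertex of `D•` over `𝒳 = Th•_T[Z]`: the identity at `𝒳_⋎` and `□`,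
`κ_{An•} ⋙ φ_{An•}` after the natural functors to `ℰ•` on rows 3–5, `φ_{An•}` at `An•[𝒳]`, `κ₂⁻¹ ⋙ φ_{An•}` at
the `ℰ•` of row 7. [cite: MochizukiAbsTopIII2015, Cor 5.5 (ii) p.130] -/
noncomputable def holOverX : (x : DVertex Vmod isArc) → x.IsHolomorphic → (x.category L ⥤ L.X)
  | .row1 _, _ => 𝟭 L.X
  | .core, _ => 𝟭 L.X
  | .nplus v, _ => (L.forget v ⋙ L.toE v) ⋙ (L.κAn.functor ⋙ L.φAn)
  | .nv v, _ => L.toE v ⋙ (L.κAn.functor ⋙ L.φAn)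
  | .e5, _ => L.κAn.functor ⋙ L.φAn
  | .an, _ => L.φAn
  | .e7, _ => L.κAn₂.inverse ⋙ L.φAn
  | .nmonoPlus _, h => False.elim h
  | .nmono _, h => False.elim h
  | .emono5, h => False.elim h
  | .anMono, h => False.elim h
  | .emono7, h => False.elim h

/-- Every arrow of `D•` lies over `𝒳`: `log` by `logIsoId`, `id_⋎` trivially, `λ⊞_{v,ν}` by "`λ⊞_{v,ν}` lies over
`Th•[Z]`" (`lamOver`) followed by `η_{An•} : φ_{An•} ∘ π_{An•} ≅ id_𝒳`, the remaining arrows by associators /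
the unit of `κ₂` ("immediate from the definitions", p. 132). [cite: MochizukiAbsTopIII2015, Cor 5.5 (ii) p.132] -/
noncomputable def holOverXIso : {a b : DVertex Vmod isArc} → (e : DEdge isArc a b) → (ha : a.IsHolomorphic) →
    (hb : b.IsHolomorphic) → (DEdge.functor L e ⋙ L.holOverX b hb ≅ L.holOverX a ha)
  | _, _, .log _, _, _ => L.log.rightUnitor ≪≫ L.logIsoId
  | _, _, .toCore _, _, _ => Functor.leftUnitor _
  | _, _, .lam v ν _, _, _ =>
    (Functor.associator _ _ _).symm ≪≫ Functor.isoWhiskerRight (L.lamOver v ν) (L.κAn.functor ⋙ L.φAn) ≪≫ L.ηAn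
  | _, _, .forget _, _, _ => (Functor.associator _ _ _).symm
  | _, _, .toE _, _, _ => Iso.refl _
  | _, _, .κAn, _, _ => Iso.refl _
  | _, _, .anToE, _, _ =>
    (Functor.associator _ _ _).symm ≪≫ Functor.isoWhiskerRight L.κAn₂.unitIso.symm L.φAn ≪≫ L.φAn.leftUnitor
  | _, _, .monoNplus _, _, hb => False.elim hb
  | _, _, .monoN _, _, hb => False.elim hb
  | _, _, .monoE5, _, hb => False.elim hb
  | _, _, .monoAn, _, hb => False.elim hb
  | _, _, .monoE7, _, hb => False.elim hb
  | _, _, .forgetMono _, _, hb => False.elim hb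
  | _, _, .toEmono _, _, hb => False.elim hb
  | _, _, .κAnMono, _, hb => False.elim hb
  | _, _, .anMonoToE, _, hb => False.elim hb

/-- The structure functors of `D•_{≤5}` over `𝒳` (abc-iut-L4-t12's `OverData`).
[cite: MochizukiAbsTopIII2015, Cor 5.5 (ii) p.130] -/
noncomputable def contactBase : (L.subdiagram (InFive (isArc := isArc))).OverData L.X where
  N a := L.holOverX a.1 a.2.1
  μ e := L.holOverXIso e _ _

/-- `φ_{An•}` is fully faithful ("the equivalence of categories given by the forgetful functor").
[cite: MochizukiAbsTopIII2015, Cor 5.5 p.130] -/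
noncomputable def φAnFullyFaithful : L.φAn.FullyFaithful := by
  haveI := L.φAn_isEquivalence
  exact Functor.FullyFaithful.ofFullyFaithful L.φAn

/-- The observation edge `κ_{An•} : ℰ• → An•[𝒳]` lies over `𝒳`. [cite: MochizukiAbsTopIII2015, Cor 5.5 (i) p.130] -/
noncomputable def contactObsIso : ∀ (a : DSub (InFive (Vmod := Vmod) (isArc := isArc))) (i : DEdge isArc a.1 .an),
    DEdge.functor L i ⋙ L.φAn ≅ L.contactBase.N a
  | ⟨_, _⟩, .κAn => Iso.refl _

/-- The telecore edges `φ_⋏ = φ_{An•}`, `⋏ ∈ L ∪ {□}`, lie over `𝒳` (trivially: the structure functor at `⋏` is the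
identity). [cite: MochizukiAbsTopIII2015, Cor 5.5 (ii) p.130] -/
noncomputable def contactTelIso : ∀ (a : DSub (InFive (Vmod := Vmod) (isArc := isArc))) (j : TelecoreIdx a.1),
    L.telecoreFun a.1 j ⋙ L.contactBase.N a ≅ L.φAn
  | ⟨.row1 _, _⟩, _ => L.φAn.rightUnitor
  | ⟨.core, _⟩, _ => L.φAn.rightUnitor
  | ⟨.nplus _, _⟩, j => PEmpty.elim j
  | ⟨.nv _, _⟩, j => PEmpty.elim j
  | ⟨.e5, _⟩, j => PEmpty.elim j
  | ⟨.an, _⟩, j => PEmpty.elim j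
  | ⟨.e7, _⟩, j => PEmpty.elim j
  | ⟨.nmonoPlus _, _⟩, j => PEmpty.elim j
  | ⟨.nmono _, _⟩, j => PEmpty.elim j
  | ⟨.emono5, _⟩, j => PEmpty.elim j
  | ⟨.anMono, _⟩, j => PEmpty.elim j
  | ⟨.emono7, _⟩, j => PEmpty.elim j

/-! ## The telecore `𝔗_{An•}` and the universal family of `D_{An•}` -/

/-- the telecore edges `J` of `𝔗_{An•}` (`TelecoreIdx`), on the vertices of `D•_{≤5}`. [cite: MochizukiAbsTopIII2015, Cor 5.5 (ii) p.130] -/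
abbrev anTelJ : DSub (InFive (Vmod := Vmod) (isArc := isArc)) → Type u := fun a => TelecoreIdx a.1

/-- The structure functors of `D_{An•}` over `𝒳` (t5's `teleOver`). [cite: MochizukiAbsTopIII2015, Cor 5.5 (ii) p.130] -/
noncomputable def contactOver : (L.anTelecoreDiagram anTelJ (fun {a} j => L.telecoreFun a.1 j)).OverData L.X :=
  teleOver (obsShape InFive .an) (L.obsExt InFive .an) L.contactBase L.φAn L.contactObsIso anTelJ
    (fun {a} j => L.telecoreFun a.1 j) L.contactTelIso

/-- The vertices of `D_{An•}` used as fully faithful vertices: `An•[𝒳]`, `□` and the `𝒳_⋎`.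
[cite: MochizukiAbsTopIII2015, Cor 5.5 (ii) p.131] -/
def contactW : (anTelecoreShape (Vmod := Vmod) (isArc := isArc) anTelJ).Vertex → Prop
  | ExtVertex.obs => True
  | ExtVertex.base ⟨.core, _⟩ => True
  | ExtVertex.base ⟨.row1 _, _⟩ => True
  | ExtVertex.base ⟨.nplus _, _⟩ => False
  | ExtVertex.base ⟨.nv _, _⟩ => False
  | ExtVertex.base ⟨.e5, _⟩ => False
  | ExtVertex.base ⟨.an, _⟩ => False
  | ExtVertex.base ⟨.e7, _⟩ => False
  | ExtVertex.base ⟨.nmonoPlus _, _⟩ => False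
  | ExtVertex.base ⟨.nmono _, _⟩ => False
  | ExtVertex.base ⟨.emono5, _⟩ => False
  | ExtVertex.base ⟨.anMono, _⟩ => False
  | ExtVertex.base ⟨.emono7, _⟩ => False

/-- The structure functors at the vertices of `contactW` are fully faithful (`φ_{An•}`, identities). [folklore] -/
noncomputable def contactFF : ∀ w, contactW w → ((L.contactOver).N w).FullyFaithful
  | ExtVertex.obs, _ => L.φAnFullyFaithful
  | ExtVertex.base ⟨.core, _⟩, _ => Functor.FullyFaithful.id L.X
  | ExtVertex.base ⟨.row1 _, _⟩, _ => Functor.FullyFaithful.id L.X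
  | ExtVertex.base ⟨.nplus _, _⟩, h => h.elim
  | ExtVertex.base ⟨.nv _, _⟩, h => h.elim
  | ExtVertex.base ⟨.e5, _⟩, h => h.elim
  | ExtVertex.base ⟨.an, _⟩, h => h.elim
  | ExtVertex.base ⟨.e7, _⟩, h => h.elim
  | ExtVertex.base ⟨.nmonoPlus _, _⟩, h => h.elim
  | ExtVertex.base ⟨.nmono _, _⟩, h => h.elim
  | ExtVertex.base ⟨.emono5, _⟩, h => h.elim
  | ExtVertex.base ⟨.anMono, _⟩, h => h.elim
  | ExtVertex.base ⟨.emono7, _⟩, h => h.elim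

/-- **The universal family `K` of `D_{An•}`** for the fully faithful vertices `{An•[𝒳], □, 𝒳_⋎}`.
[cite: MochizukiAbsTopIII2015, Cor 5.5 (ii) p.131] -/
noncomputable def contactUniv : (L.anTelecoreDiagram anTelJ (fun {a} j => L.telecoreFun a.1 j)).HomotopyFamily :=
  teleUnivFamily (obsShape InFive .an) (L.obsExt InFive .an) L.contactBase L.φAn L.contactObsIso anTelJ
    (fun {a} j => L.telecoreFun a.1 j) L.contactTelIso contactW L.contactFF

/-! ## The printed generators and the contact structure `ℋ_{An•}` -/

section Generators

variable (vc : Vmod) (νc : LogVertex (isArc vc)) (hνc : νc.isPostLog = false)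
  (vr : ℤ → Vmod) (νr : ∀ n, LogVertex (isArc (vr n))) (hνr : ∀ n, (νr n).isPostLog = false)

/-- The printed generating pairs of `ℋ_{An•}` (for chosen descending paths): `([φ_□], [id_⋎]∘[φ_⋎])`,
`([β¹_□], [β⁰_□])`, `([β¹_⋎], [β⁰_⋎])`, each in both orders — literally the generating set of
`IsAnContactGenerated`. [cite: MochizukiAbsTopIII2015, Cor 5.5 (ii) p.131] -/
def contactGen : ∀ ⦃a b : (anTelecoreShape (Vmod := Vmod) (isArc := isArc) anTelJ).Vertex⦄, Path a b → Path a b → Prop :=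
  fun ⦃a b⦄ p q =>
    (∃ (n : ℤ) (jc : anTelJ (isArc := isArc) ⟨.core, core_mem_five⟩) (jn : anTelJ (isArc := isArc) ⟨.row1 n, row1_mem_five n⟩)
        (_ : a = (anTelecoreShape anTelJ).obs) (_ : b = (anTelecoreShape anTelJ).base ⟨.core, core_mem_five⟩),
      (HEq p (phiCorePath anTelJ jc) ∧ HEq q (phiRowPath anTelJ n jn)) ∨
        (HEq p (phiRowPath anTelJ n jn) ∧ HEq q (phiCorePath anTelJ jc))) ∨
    (∃ (jc : anTelJ (isArc := isArc) ⟨.core, core_mem_five⟩) (_ : a = (anTelecoreShape anTelJ).base ⟨.core, core_mem_five⟩)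
        (_ : b = a),
      (HEq p (betaCorePath anTelJ vc νc hνc jc) ∧ HEq q (Path.nil : Path a a)) ∨
        (HEq p (Path.nil : Path a a) ∧ HEq q (betaCorePath anTelJ vc νc hνc jc))) ∨
    (∃ (n : ℤ) (jn : anTelJ (isArc := isArc) ⟨.row1 n, row1_mem_five n⟩)
        (_ : a = (anTelecoreShape anTelJ).base ⟨.row1 n, row1_mem_five n⟩) (_ : b = a),
      (HEq p (betaRowPath anTelJ n (vr n) (νr n) (hνr n) jn) ∧ HEq q (Path.nil : Path a a)) ∨
        (HEq p (Path.nil : Path a a) ∧ HEq q (betaRowPath anTelJ n (vr n) (νr n) (hνr n) jn)))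

/-- The printed generators lie in the boundary set of `K` (they end at `□` or at some `𝒳_⋎`).
[cite: MochizukiAbsTopIII2015, Cor 5.5 (ii) p.131] -/
theorem contactGen_subset ⦃a b : (anTelecoreShape (Vmod := Vmod) (isArc := isArc) anTelJ).Vertex⦄ ⦃p q : Path a b⦄
    (h : contactGen vc νc hνc vr νr hνr p q) : (L.contactUniv).E p q := by
  rcases h with ⟨n, jc, jn, rfl, rfl, -⟩ | ⟨jc, rfl, rfl, -⟩ | ⟨n, jn, rfl, rfl, -⟩
  · exact univE_of_mem _ trivial _ _
  · exact univE_of_mem _ trivial _ _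
  · exact univE_of_mem _ trivial _ _

/-- **The contact structure `ℋ_{An•}`**: the universal family `K` restricted to the family GENERATED by the printed
pairs. [cite: MochizukiAbsTopIII2015, Cor 5.5 (ii) p.131] -/
noncomputable def contactFamily : (L.anTelecoreDiagram anTelJ (fun {a} j => L.telecoreFun a.1 j)).HomotopyFamily :=
  (L.contactUniv).restrictBoundary (Saturation (contactGen vc νc hνc vr νr hνr)) (isSaturated_saturation _)
    (Saturation.subset (L.contactUniv).isSaturated (L.contactGen_subset vc νc hνc vr νr hνr))

/-- `ℋ_{An•}` is generated by the printed pairs. [cite: MochizukiAbsTopIII2015, Cor 5.5 (ii) p.131] -/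
theorem contactFamily_isGeneratedBy :
    HomotopyFamily.IsGeneratedBy _ (L.contactFamily vc νc hνc vr νr hνr) (contactGen vc νc hνc vr νr hνr) :=
  fun _ _ _ _ => Iff.rfl

end Generators

end LogFrobeniusSetting

end Literature.AnabelianGeometry.AbsoluteAnabelian
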